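import Summits.ABC.IUTFork.Conditional.WRowLicenceOrbitEventuallySharpM
import HarnessLib

/-!
# Branch C / R-W, reading (U): the NON-CYCLOTOMIC levels — S_H (K and M settings) and `T.Cor312Of` at EVERY genuine Θ-datum over every
# rational point of an abc-triple orbit at EVERY prime `l ≥ 5`, `l ∤ abc`, with `l ∤ (p − 1)` for every odd `p ∣ abc` and `4·p^{⌊v_p/2⌋} < l`
# only for the odd `p` with `p² ∣ abc` — a sharpening of p508140's «`p < l`» (abc-iut cell, branch C, row «C:COR312U-NONCYCLOTOMIC»,
# sequel of p508140 / p524300 / p524995; seat abc-iut-C-cert-2 gen 7)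

Record-only PROOF file (D-0012; 0 definitions, 0 `Prop` facts, nothing re-typed) of the abc-iut cell. TAKES NO SIDE on [IUTchIII] Cor. 3.12
(S. Mochizuki, *Inter-universal Teichmüller theory III*, Cor. 3.12 p. 173–174; Step (xi-f) p. 184) or on any author; «inhabited as typed» ≠
«asserted in print».

WHY. p508140's `WRow.hcell_triple_of_primePow_lt` used `p < l` for an odd bad prime `p` exactly twice: (1) to put `e` (a multiple of `l`) OFF
the cyclotomic indices `p^m·(p−1)` — but `l ∣ p^m(p−1)` only needs `l = p` or `l ∣ (p−1)`, so `p ≠ l ∧ l ∤ (p−1)` suffices (automatic when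
`p < l`); (2) for `2·p^{⌊v_p/2⌋} ≤ (l−1)/2` — but at a prime with `v_p(abc) = 1` the exponent is `0` and the cell needs only `l ≥ 5`. Hence:

* **`WRow.hcell_triple_of_nonCyclotomic`** — the twist-free `hcell` for EVERY abc triple at EVERY prime `l ≥ 5` such that every odd `p ∣ abc` has
  `p ≠ l`, `l ∤ (p − 1)`, and (`v_p(abc) ≤ 1` or `4·p^{⌊v_p(abc)/2⌋} < l`) (proof = p508140's with the two uses replaced);
* **`WRow.licence_orbit_of_nonCyclotomic`**, **`WRow.cor312Of_orbit_of_nonCyclotomic`** — S_H's licence (K setting) and `T.Cor312Of` at every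
  genuine datum over every rational `q` with `j(q) = j(a/c)` at such primes (the j-free orbit socket p524300);
* **`WRowM.licence_orbit_of_nonCyclotomic`** — the same for the M-LEVEL setting of the own ideles (p524995's socket).

READING (numbers, not adjectives): for SQUAREFREE `abc` the (U) licences and `T.Cor312Of` hold at EVERY prime `l ≥ 5` NOT dividing
`abc·∏_{p ∣ abc, p odd}(p − 1)` — a FINITE exceptional set of levels per triple, instead of p508140's «every `l` above the largest odd bad prime»;
in general the primes `l` with `l ∣ (p−1)` for some odd bad `p`, `l ∣ abc`, or `l ≤ 4·p^{⌊v_p/2⌋}` for some odd `p² ∣ abc` remain. Example: `1 + 8 = 9`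
(`abc = 72 = 2³3²`): odd bad prime `3` (`v = 2`, `4·3 = 12`): every prime `l ≥ 13` (as before); `5 + 27 = 32` (`abc = 2⁵3³5`): `3` has `v = 3`
(`4·3 = 12 < l`), `5` has `v = 1` (needs only `l ∤ 4`, `l ≠ 5`) — so every prime `l ≥ 13`; `1 + 22 = 23` (`abc = 2·11·23`, squarefree): every
prime `l ≥ 7` other than `11` and `23` (`5 ∣ 11 − 1` excludes `l = 5`; `11 ∣ 23 − 1` and `11, 23 ∣ abc`) — where p508140 needed `l > 23`. Per-triple lists are the R-W table's business; this
file is the closed form. HONEST SCOPE: OUR sharp containers and Dupuy–Hilado's typed (Ind1)/(Ind2); STRONGER-THAN-PRINT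
hull reading; non-emptiness / admissibility / Szpiro-badness NOT claimed; nothing about the printed GLOBAL inequality or print's own `l`; the
cyclotomic levels `l ∣ (p−1)` are NOT claimed either way here (there `e` may be a cyclotomic index and the envelope member degenerates — the
R-W «tie»/ceiling analysis, W-neg-1's lane); typed ≠ proved; instantiated ≠ endorsed; no abc claim. [cite: Mochizuki2012, IUTchI Def. 3.1
(b),(c) pp. 61–62, Ex. 3.2 (iv) p. 71; IUTchIII Cor. 3.12 p. 173–174, Step (xi-f) p. 184; IUTchIV Prop. 1.2 (i)(ii) p. 10, Prop. 1.4 (ii) p. 13,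
Cor. 2.2 (ii) proof (P5) p. 46] [cite: DupuyHilado2025, §3.3, §3.4, §4.9, §4.12] [claim: Mochizuki2012, status: disputed] for every IUT sentence.
PROOF-ONLY: no definitions.
-/

noncomputable section

open Set Function NumberField IsDedekindDomain

namespace Summit.ABC.IUTFork.Conditional

open Thm311 Thm311.Real Cor312 Cor312Vol Cor312Prov Literature.IUT.LogThetaLattice Literature.IUT.LogVolume
  Literature.IUT.HodgeTheaters Literature.IUT.LogVolume.ThetaData Literature.IUT.LogVolume.Cor22
open Literature.NumberTheory.NumberFields Literature.NumberTheory.GaloisRepresentations.Ultrametric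
open Literature.NumberTheory.DiophantineGeometry Literature.NumberTheory.DiophantineGeometry.GenEll Summit.ABC.ABC.Theorems

/-! ## §1. The cells at the non-cyclotomic levels -/

/-- **`hcell` (twist-free) for EVERY abc triple at EVERY prime `l ≥ 5` off `abc` and off the `p − 1` (odd `p ∣ abc`), with `4·p^{⌊v_p/2⌋} < l`
demanded only at the odd `p` with `v_p(abc) ≥ 2`.** p508140's proof with `p < l` replaced by `p ≠ l ∧ l ∤ (p−1)` in the off-cyclotomic step and
by `l ≥ 5` at the primes with `⌊v_p/2⌋ = 0`. [cite: Mochizuki2012, IUTchIV Prop. 1.2 (i)(ii) p. 10, Prop. 1.4 (ii) p. 13] [cite: DupuyHilado2025, §4.9]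
[claim: Mochizuki2012, status: disputed] -/
theorem WRow.hcell_triple_of_nonCyclotomic {a b c l : ℕ} (habc : IsABCTriple a b c) (hl : l.Prime) (hl5 : 5 ≤ l)
    (hnc : ∀ p : ℕ, p.Prime → p ∣ a * b * c → p ≠ 2 →
      p ≠ l ∧ ¬ l ∣ p - 1 ∧ ((a * b * c).factorization p < 2 ∨ 4 * p ^ ((a * b * c).factorization p / 2) < l)) :
    ∀ p : ℕ, p.Prime → p ∣ a * b * c → p ≠ 2 → p ≠ l → ∀ e : ℕ, 0 < e → l ∣ e →
      15 * l ∣ e * (a * b * c).factorization p → (p ∣ 30 → (p - 1) ∣ e) →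
      (∀ k : ℕ, (e : ℤ) ≠ (p : ℤ) ^ k * ((p : ℤ) - 1)) ∧
      ∀ i : ℕ, i < (l - 1) / 2 →
        (e : ℤ) * ((((i + 1 : ℕ) : ℤ) ^ 2 * ((e * (2 * (a * b * c).factorization p) / (2 * l) : ℕ) : ℤ) -
            ((i + 1 : ℕ) : ℤ) * (((if p ∣ 30 ∧ ¬ p ∣ (a * b * c).factorization p then 2 * e - 1 else e - 1 : ℕ) : ℕ) : ℤ) -
            ((i + 2 : ℕ) : ℤ) * (if p ∣ 30 then (((e / (p - 1) : ℕ) : ℤ)) else (1 : ℤ))) / (e : ℤ)) +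
          ((i + 2 : ℕ) : ℤ) * min ((p : ℤ) ^ ((fun p => (a * b * c).factorization p / 2) p) -
              (((fun p => (a * b * c).factorization p / 2) p : ℕ) : ℤ) * (e : ℤ))
            ((p : ℤ) ^ ((fun p => (a * b * c).factorization p / 2) p) -
              (((fun p => (a * b * c).factorization p / 2) p : ℕ) : ℤ) * (e : ℤ)) ≤
        ((e * (2 * (a * b * c).factorization p) / (2 * l) : ℕ) : ℤ) := by
  intro p hp hpabc hp2 hpl e he hle _h15 _h30
  simp only []
  obtain ⟨hpl', hndvd, h4⟩ := hnc p hp hpabc hp2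
  have ha : 0 < a := habc.1
  have hb : 0 < b := habc.2.1
  have hc : 0 < c := by have := habc.2.2.1; omega
  have hN : 0 < a * b * c := by positivity
  -- notation
  set v := (a * b * c).factorization p with hv
  set A := v / 2 with hA
  have hv1 : 1 ≤ v := Nat.Prime.factorization_pos_of_dvd hp hN.ne' hpabc
  obtain ⟨k, rfl⟩ := hle
  have hk : 1 ≤ k := by
    rcases Nat.eq_zero_or_pos k with h | h
    · simp [h] at he
    · exact h
  refine ⟨fun m heq => ?_, fun i hi => ?_⟩
  · -- off the cyclotomic indices: `l ∣ p^m (p-1)` is impossible for the prime `l > p`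
    have hcast : ((p : ℤ) - 1) = ((p - 1 : ℕ) : ℤ) := by rw [Nat.cast_sub hp.one_le]; simp
    rw [hcast] at heq
    have heqN : l * k = p ^ m * (p - 1) := by exact_mod_cast heq
    have hdvd : l ∣ p ^ m * (p - 1) := ⟨k, heqN.symm⟩
    rcases (Nat.Prime.prime hl).dvd_or_dvd hdvd with h | h
    · exact hpl' ((Nat.prime_dvd_prime_iff_eq hl hp).1 (hl.dvd_of_dvd_pow h)).symm
    · exact hndvd h
  · -- the label cell
    -- `l = 2L + 1`
    have hl2 : l ≠ 2 := by omega
    have hodd : l % 2 = 1 := Nat.odd_iff.1 (hl.eq_two_or_odd'.resolve_left hl2)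
    set L := (l - 1) / 2 with hL
    have hlL : l = 2 * L + 1 := by omega
    -- the `q`-pilot order `e·2v/(2l) = k·v`
    have hH : l * k * (2 * v) / (2 * l) = k * v := by
      rw [show l * k * (2 * v) = (2 * l) * (k * v) by ring]
      exact Nat.mul_div_cancel_left _ (by omega)
    rw [hH]
    -- the floor and the `min`
    have he0 : ((l * k : ℕ) : ℤ) ≠ 0 := by exact_mod_cast he.ne'
    have hfloor : ∀ x : ℤ, ((l * k : ℕ) : ℤ) * (x / ((l * k : ℕ) : ℤ)) ≤ x := fun x => by
      rw [mul_comm]; exact Int.ediv_mul_le x he0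
    -- the different term and the inner-radius term
    have hD : (2 * (L : ℤ) + 1) * k - 1 ≤
        (((if p ∣ 30 ∧ ¬ p ∣ v then 2 * (l * k) - 1 else l * k - 1 : ℕ) : ℕ) : ℤ) := by
      have hlk1 : 1 ≤ l * k := he
      split_ifs
      · rw [Nat.cast_sub (by omega)]; push_cast; rw [hlL]; push_cast; nlinarith
      · rw [Nat.cast_sub hlk1]; push_cast; rw [hlL]; push_cast; linarith
    have hR : (0 : ℤ) ≤ (if p ∣ 30 then (((l * k / (p - 1) : ℕ) : ℤ)) else (1 : ℤ)) := by
      split_ifs <;> positivity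
    -- the core estimate
    have hJL : ((i + 1 : ℕ) : ℤ) ≤ L := by
      have : i + 1 ≤ L := hi
      exact_mod_cast this
    have hVA : (v : ℤ) ≤ 2 * (A : ℤ) + 1 := by
      have : v ≤ 2 * A + 1 := by omega
      exact_mod_cast this
    have hP1 : (1 : ℤ) ≤ (p : ℤ) ^ A := by exact_mod_cast Nat.one_le_pow A p hp.pos
    have hLP : 2 * (p : ℤ) ^ A ≤ L := by
      have : 2 * p ^ A ≤ L := by
        rcases h4 with hv2 | h4
        · have hA0 : A = 0 := by omega
          rw [hA0, pow_zero]; omega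
        · omega
      exact_mod_cast this
    have core := WRow.cell_core_of_large ((i + 1 : ℕ) : ℤ) L k v A ((p : ℤ) ^ A) _ _
      (by exact_mod_cast Nat.succ_pos i) hJL (by exact_mod_cast hk) (by positivity) (by positivity) hVA hP1 hLP hD hR
    -- rewrite `i + 2 = (i+1) + 1` and `e = (2L+1)·k` in the goal, then chain
    have hi2 : ((i + 2 : ℕ) : ℤ) = ((i + 1 : ℕ) : ℤ) + 1 := by push_cast; ring
    have hlZ : (l : ℤ) = 2 * (L : ℤ) + 1 := by rw [hlL]; push_cast; ring
    have hmin := min_le_left ((p : ℤ) ^ A - (A : ℤ) * ((l * k : ℕ) : ℤ)) ((p : ℤ) ^ A - (A : ℤ) * ((l * k : ℕ) : ℤ))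
    have hJ1' : (0 : ℤ) ≤ ((i + 2 : ℕ) : ℤ) := by positivity
    have hmin' := mul_le_mul_of_nonneg_left hmin hJ1'
    have hfl := hfloor ((((i + 1 : ℕ) : ℤ) ^ 2 * ((k * v : ℕ) : ℤ) -
            ((i + 1 : ℕ) : ℤ) * (((if p ∣ 30 ∧ ¬ p ∣ v then 2 * (l * k) - 1 else l * k - 1 : ℕ) : ℕ) : ℤ) -
            ((i + 2 : ℕ) : ℤ) * (if p ∣ 30 then (((l * k / (p - 1) : ℕ) : ℤ)) else (1 : ℤ))))
    rw [hi2] at hfl hmin' ⊢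
    push_cast at core hfl hmin' ⊢
    simp only [hlZ] at core hfl hmin' ⊢
    linarith [core, hfl, hmin']

/-! ## §2. S_H (K setting), `T.Cor312Of`, and S_H,M at the non-cyclotomic levels, every rational point of the orbit -/

/-- **S_H's LICENCE (K setting) at EVERY genuine datum over EVERY rational `q` with `j(q) = j(a/c)`, at EVERY NON-CYCLOTOMIC level** (prime
`l ≥ 5`; every odd `p ∣ abc`: `p ≠ l`, `l ∤ p−1`, and `v_p ≤ 1 ∨ 4·p^{⌊v_p/2⌋} < l`), for every pair of realising ideles — the j-free orbit socket
p524300 with §1. [cite: Mochizuki2012, IUTchIII Cor. 3.12 Step (xi-f) p. 184; IUTchIV Prop. 1.2 (i)(ii) p. 10] [claim: Mochizuki2012, status: disputed] -/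
theorem WRow.licence_orbit_of_nonCyclotomic {a b c l : ℕ} (habc : IsABCTriple a b c) {q : ℚ} (hq : Cor22.jInv q = Cor22.jInv ((a : ℚ) / c))
    (hl : l.Prime) (hl5 : 5 ≤ l)
    (hnc : ∀ p : ℕ, p.Prime → p ∣ a * b * c → p ≠ 2 →
      p ≠ l ∧ ¬ l ∣ p - 1 ∧ ((a * b * c).factorization p < 2 ∨ 4 * p ^ ((a * b * c).factorization p / 2) < l))
    (T : Cor22.ThetaVolumeDatumAt (ratPoint q) l) :
    letI := T.instFieldF; letI := T.instNumberFieldF; letI := T.instAlgebraF; letI := T.instFieldK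
    letI := T.instNumberFieldK; letI := T.instAlgebraK; letI := T.instFieldFbar; letI := T.instAlgebraFbar
    letI := T.instAlgebraKFbar; letI := T.instIsElliptic
    ∀ {logv : PadicLogs T.K} (hlog : LogvAnalytic logv) (M : Type) [Field M] [NumberField M]
      (archPk : ∀ (j : (thetaIndex (pilotDataOfK T.D T.K)).Label) (vQ : (thetaIndex (pilotDataOfK T.D T.K)).VQ),
        Set ((logShellsDH (pilotDataOfK T.D T.K) logv).Packet j vQ))
      (archSub : ∀ (j : (thetaIndex (pilotDataOfK T.D T.K)).Label) (v : (thetaIndex (pilotDataOfK T.D T.K)).V),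
        Set ((logShellsDH (pilotDataOfK T.D T.K) logv).Packet j ((thetaIndex (pilotDataOfK T.D T.K)).over v)))
      (Ψ : ℤ → ∀ v : (thetaIndex (pilotDataOfK T.D T.K)).V, v ∈ (thetaIndex (pilotDataOfK T.D T.K)).Vbad →
        Set ((logShellsDH (pilotDataOfK T.D T.K) logv).StarPacket v))
      (act : ℤ → ∀ v : (thetaIndex (pilotDataOfK T.D T.K)).V, v ∈ (thetaIndex (pilotDataOfK T.D T.K)).Vbad →
        (logShellsDH (pilotDataOfK T.D T.K) logv).StarPacket v → Module.End ℚ ((logShellsDH (pilotDataOfK T.D T.K) logv).StarPacket v))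
      (Mmod : ℤ → ∀ j : (thetaIndex (pilotDataOfK T.D T.K)).LabelStar, Set ((logShellsDH (pilotDataOfK T.D T.K) logv).GlobalPacket j.1))
      (region : ℤ → ∀ j : (thetaIndex (pilotDataOfK T.D T.K)).LabelStar, FinDivisor M → ∀ vQ : (thetaIndex (pilotDataOfK T.D T.K)).VQ,
        Set ((logShellsDH (pilotDataOfK T.D T.K) logv).Packet j.1 vQ))
      (n : ℤ) {HT : Type} {LogLink : HT → HT → Type} {IsFull : ∀ {s t : HT}, LogLink s t → Prop}
      (lat : LGPGaussianLogThetaLattice LogLink IsFull)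
      {Frd : Type} {IsoF : Frd → Frd → Type} {Ob : Frd → Type} {realify : Frd → Frd} {Strip : Type}
      {IsoS : Strip → Strip → Type} {Mv : ∀ v : (thetaIndex (pilotDataOfK T.D T.K)).V, v ∈ (thetaIndex (pilotDataOfK T.D T.K)).Vbad → Type}
      [∀ v h, Monoid (Mv v h)]
      (sig : GlobalLGPFrobenioidSignature (thetaIndex (pilotDataOfK T.D T.K)).lstar (thetaIndex (pilotDataOfK T.D T.K)).V
        (· ∈ (thetaIndex (pilotDataOfK T.D T.K)).Vbad) Frd IsoF Ob realify Strip IsoS Mv)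
      (split : SplittingMonoids Mv) {ObΔ : Type} {N : ∀ v : (thetaIndex (pilotDataOfK T.D T.K)).V, v ∈ (thetaIndex (pilotDataOfK T.D T.K)).Vbad → Type}
      [∀ v h, Monoid (N v h)] (qData : QPilotData ObΔ N)
      (tq : ∀ (pp : Nat.Primes) (x : (thetaIndex (pilotDataOfK T.D T.K)).Fibre (.inr pp)),
        haveI : Fact (pp : ℕ).Prime := ⟨pp.2⟩; kOf (pilotDataOfK T.D T.K) pp.1 x)
      (t : ∀ (pp : Nat.Primes) (_ : Fin (pilotDataOfK T.D T.K).lstar) (x : (thetaIndex (pilotDataOfK T.D T.K)).Fibre (.inr pp)),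
        haveI : Fact (pp : ℕ).Prime := ⟨pp.2⟩; kOf (pilotDataOfK T.D T.K) pp.1 x)
      (htq0 : ∀ pp x, tq pp x ≠ 0)
      (htq1 : ∀ (pp : Nat.Primes) (x : (thetaIndex (pilotDataOfK T.D T.K)).Fibre (.inr pp)),
        haveI : Fact (pp : ℕ).Prime := ⟨pp.2⟩; placeOf (pilotDataOfK T.D T.K) pp.1 x ∉ (pilotDataOfK T.D T.K).S → ‖tq pp x‖ = 1)
      (_ht0 : ∀ pp i x, t pp i x ≠ 0)
      (_ht : ∀ (pp : Nat.Primes) (i : Fin (pilotDataOfK T.D T.K).lstar) (x : (thetaIndex (pilotDataOfK T.D T.K)).Fibre (.inr pp)),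
        haveI : Fact (pp : ℕ).Prime := ⟨pp.2⟩
        Real.log ‖t pp i x‖ = -((pilotDataOfK T.D T.K).thetaPilot i (placeOf (pilotDataOfK T.D T.K) pp.1 x)) *
          logNorm T.K (placeOf (pilotDataOfK T.D T.K) pp.1 x) / localDegree T.K (placeOf (pilotDataOfK T.D T.K) pp.1 x))
      (_htq : ∀ (pp : Nat.Primes) (x : (thetaIndex (pilotDataOfK T.D T.K)).Fibre (.inr pp)),
        haveI : Fact (pp : ℕ).Prime := ⟨pp.2⟩
        Real.log ‖tq pp x‖ = -((pilotDataOfK T.D T.K).qPilot (placeOf (pilotDataOfK T.D T.K) pp.1 x)) *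
          logNorm T.K (placeOf (pilotDataOfK T.D T.K) pp.1 x) / localDegree T.K (placeOf (pilotDataOfK T.D T.K) pp.1 x)),
      Thm311ToCor312.Licence
        (settingPrVolSharp (pilotDataOfK T.D T.K) hlog M archPk archSub Ψ act Mmod region n lat sig split qData tq t htq0 htq1) :=
  WRow.licence_orbit_unconditional habc hq T (fun p => (a * b * c).factorization p / 2)
    (fun p => (a * b * c).factorization p / 2) (WRow.hcell_triple_of_nonCyclotomic habc hl hl5 hnc)

/-- **`T.Cor312Of` (READING (U)) at EVERY genuine datum over EVERY rational `q` with `j(q) = j(a/c)`, at EVERY NON-CYCLOTOMIC level** — through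
p524300's `WRow.cor312Of_orbit_of_primePow_lt` route (abc-iut-C-cert-3's `GenuineK.cor312Of_of_licence` at one-point context data and the chosen
realising ideles). [cite: Mochizuki2012, IUTchIII Cor. 3.12 p. 173–174; IUTchIV Cor. 2.2 (ii) proof (P5) p. 46] [claim: Mochizuki2012, status: disputed] -/
theorem WRow.cor312Of_orbit_of_nonCyclotomic {a b c l : ℕ} (habc : IsABCTriple a b c) {q : ℚ} (hq : Cor22.jInv q = Cor22.jInv ((a : ℚ) / c))
    (hl : l.Prime) (hl5 : 5 ≤ l)
    (hnc : ∀ p : ℕ, p.Prime → p ∣ a * b * c → p ≠ 2 →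
      p ≠ l ∧ ¬ l ∣ p - 1 ∧ ((a * b * c).factorization p < 2 ∨ 4 * p ^ ((a * b * c).factorization p / 2) < l))
    (T : Cor22.ThetaVolumeDatumAt (ratPoint q) l) : T.Cor312Of := by
  letI := T.instFieldF; letI := T.instNumberFieldF; letI := T.instAlgebraF; letI := T.instFieldK
  letI := T.instNumberFieldK; letI := T.instAlgebraK; letI := T.instFieldFbar; letI := T.instAlgebraFbar
  letI := T.instAlgebraKFbar; letI := T.instIsElliptic
  obtain ⟨tq, htq0, htq1, htq⟩ := exists_realising_qIdeles_pilotDataOfK T.D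
  obtain ⟨t, ht0, ht1, ht⟩ := exists_realising_thetaIdeles_pilotDataOfK T.D
  exact GenuineK.cor312Of_of_licence T.D T.K ℚ (fun _ _ => ∅) (fun _ _ => ∅) (fun _ _ _ => ∅) (fun _ _ _ => 0) (fun _ _ => ∅)
    (fun _ _ _ _ => ∅) 0 unitLatticeDH (unitSigDH (pilotDataOfK T.D T.K)) (unitSplitDH (pilotDataOfK T.D T.K))
    (unitQDataDH (pilotDataOfK T.D T.K)) t tq T.isVolumeInputOf htq0 htq1 ht0 ht1 htq
    (WRow.licence_orbit_of_nonCyclotomic habc hq hl hl5 hnc T (logvAnalytic_analyticLogv (F := T.K)) ℚ (fun _ _ => ∅) (fun _ _ => ∅)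
      (fun _ _ _ => ∅) (fun _ _ _ => 0) (fun _ _ => ∅) (fun _ _ _ _ => ∅) 0 unitLatticeDH (unitSigDH (pilotDataOfK T.D T.K))
      (unitSplitDH (pilotDataOfK T.D T.K)) (unitQDataDH (pilotDataOfK T.D T.K)) tq t htq0 htq1 ht0 ht htq)
    (negLogTheta_settingPrVolSharp_pilotDataOfK_le_datum T ℚ (fun _ _ => ∅) (fun _ _ => ∅) (fun _ _ _ => ∅) (fun _ _ _ => 0) (fun _ _ => ∅)
      (fun _ _ _ _ => ∅) 0 unitLatticeDH (unitSigDH (pilotDataOfK T.D T.K)) (unitSplitDH (pilotDataOfK T.D T.K)) (unitQDataDH (pilotDataOfK T.D T.K))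
      tq t htq0 htq1 ht0 ht)

/-- **S_H,M's LICENCE (the M-LEVEL setting of the own ideles) at EVERY genuine datum over EVERY rational `q` with `j(q) = j(a/c)`, at EVERY
NON-CYCLOTOMIC level** — p524995's M orbit socket with §1. [cite: Mochizuki2012, IUTchIII Cor. 3.12 Step (xi-f) p. 184; IUTchIV Prop. 1.2 (i)(ii)
p. 10] [claim: Mochizuki2012, status: disputed] -/
theorem WRowM.licence_orbit_of_nonCyclotomic {a b c l : ℕ} (habc : IsABCTriple a b c) {q : ℚ} (hq : Cor22.jInv q = Cor22.jInv ((a : ℚ) / c))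
    (hl : l.Prime) (hl5 : 5 ≤ l)
    (hnc : ∀ p : ℕ, p.Prime → p ∣ a * b * c → p ≠ 2 →
      p ≠ l ∧ ¬ l ∣ p - 1 ∧ ((a * b * c).factorization p < 2 ∨ 4 * p ^ ((a * b * c).factorization p / 2) < l))
    (T : Cor22.ThetaVolumeDatumAt (ratPoint q) l) :
    letI := T.instFieldF; letI := T.instNumberFieldF; letI := T.instAlgebraF; letI := T.instFieldK
    letI := T.instNumberFieldK; letI := T.instAlgebraK; letI := T.instFieldFbar; letI := T.instAlgebraFbar
    letI := T.instAlgebraKFbar; letI := T.instIsElliptic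
    ∀ {logvK : PadicLogsVal T.K} (hlog : LogvAnalyticVal logvK) (r : ThetaData.IdeleData T.D) (M : Type) [Field M] [NumberField M]
      (archPk : ∀ (j : (thetaIndexOfInitial T.D).Label) (vQ : (thetaIndexOfInitial T.D).VQ),
        Set ((logShellsOfInitialDH T.D logvK).Packet j vQ))
      (archSub : ∀ (j : (thetaIndexOfInitial T.D).Label) (v : (thetaIndexOfInitial T.D).V),
        Set ((logShellsOfInitialDH T.D logvK).Packet j ((thetaIndexOfInitial T.D).over v)))
      (Ψ : ℤ → ∀ v : (thetaIndexOfInitial T.D).V, v ∈ (thetaIndexOfInitial T.D).Vbad →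
        Set ((logShellsOfInitialDH T.D logvK).StarPacket v))
      (act : ℤ → ∀ v : (thetaIndexOfInitial T.D).V, v ∈ (thetaIndexOfInitial T.D).Vbad →
        (logShellsOfInitialDH T.D logvK).StarPacket v → Module.End ℚ ((logShellsOfInitialDH T.D logvK).StarPacket v))
      (Mmod : ℤ → ∀ j : (thetaIndexOfInitial T.D).LabelStar, Set ((logShellsOfInitialDH T.D logvK).GlobalPacket j.1))
      (region : ℤ → ∀ j : (thetaIndexOfInitial T.D).LabelStar, FinDivisor M → ∀ vQ : (thetaIndexOfInitial T.D).VQ,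
        Set ((logShellsOfInitialDH T.D logvK).Packet j.1 vQ))
      (n : ℤ) {HT : Type} {LogLink : HT → HT → Type} {IsFull : ∀ {s t : HT}, LogLink s t → Prop}
      (lat : LGPGaussianLogThetaLattice LogLink IsFull)
      {Frd : Type} {IsoF : Frd → Frd → Type} {Ob : Frd → Type} {realify : Frd → Frd} {Strip : Type}
      {IsoS : Strip → Strip → Type}
      {Mv : ∀ v : (thetaIndexOfInitial T.D).V, v ∈ (thetaIndexOfInitial T.D).Vbad → Type} [∀ v h, Monoid (Mv v h)]
      (sig : GlobalLGPFrobenioidSignature (thetaIndexOfInitial T.D).lstar (thetaIndexOfInitial T.D).V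
        (· ∈ (thetaIndexOfInitial T.D).Vbad) Frd IsoF Ob realify Strip IsoS Mv)
      (split : SplittingMonoids Mv) {ObΔ : Type}
      {N : ∀ v : (thetaIndexOfInitial T.D).V, v ∈ (thetaIndexOfInitial T.D).Vbad → Type} [∀ v h, Monoid (N v h)]
      (qData : QPilotData ObΔ N)
      (htq0 : ∀ (u : FinitePlace ℚ) (x : (thetaIndexOfInitial T.D).Fibre (Val.non u)),
        tqM T.D (ratChar u) u (natCast_ratChar_mem u) r x ≠ 0)
      (Sq : Finset (FinitePlace ℚ))
      (htq1 : ∀ (u : FinitePlace ℚ) (x : (thetaIndexOfInitial T.D).Fibre (Val.non u)), u ∉ Sq →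
        ‖tqM T.D (ratChar u) u (natCast_ratChar_mem u) r x‖ = 1),
      Thm311ToCor312.Licence
        (settingPrVolSharpM T.D hlog (tOfIdeleData T.D r) (fun u x => tqM T.D (ratChar u) u (natCast_ratChar_mem u) r x) M archPk
          archSub Ψ act Mmod region n lat sig split qData htq0 Sq htq1) :=
  WRowM.licence_orbit_unconditional habc hq T (fun p => (a * b * c).factorization p / 2)
    (fun p => (a * b * c).factorization p / 2) (WRow.hcell_triple_of_nonCyclotomic habc hl hl5 hnc)

end Summit.ABC.IUTFork.Conditional

end
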